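import Summits.AtomisticToContinuum.Crystallization.Theorems.HullExactificationCascadeZeroDefectDensityLinkQAux
import HarnessLib

/-!
# Quantitative link lemma for the birth line — part 2/2: the lemma in space
# (route `HullExactificationCascade`, crux `ZeroDefectDensity`, stmt-AtomisticToContinuum-12086; line `birth`,
# stub `stub_linkQ`, registered signature verbatim)

Setting of the link lemma (`stub_linkLemma`): apex `p`, shell vertex `c`, the four common soft
contacts `n₁, …, n₄` of `p` and `c`, all eleven lengths in the band `[1 - η, 1 + η]`,
`η ≤ 1/1000`; NEW: two "square" pairs are pinned, `|d² - 2| ≤ 38 η` (type A: `n₂n₃`, `n₄n₁`;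
type B: `n₃n₄`, `n₄n₁`), and only the two diagonals are assumed far (`≥ 131/100`).
Conclusions: type A `|d₁₃² - 3|, |d₂₄² - 3| ≤ 40 η`; type B `|d₁₃² - 8/3| ≤ 60 η`,
`|d₂₄² - 3| ≤ 40 η`.

Proof.  In the cylindrical frame of `a = p - c` (`link_frame`, landed) the points `bᵢ = nᵢ - c`
have `αᵢ = 1/2 ± 2.51 η`, `ρᵢ² = 3/4 ± 4.53 η` (`linkQ_vpoint`); a soft contact has planar
cosine `1/3 ± 9.5 η` (`linkQ_vcontact`), a pinned square `-1/3 ± 33.7 η` (`linkQ_vsquare`), a far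
pair `≤ -0.136` (`link_vfar`, landed).  Part 1 (`linkQ_antipodal`: contact ∘ square is antipodal up
to `1.09 η`, the antipode being a stationary point of the cosine; `linkQ_twoContacts`:
contact ∘ contact has cosine `-7/9 ± 12.9 η`) and the conversions `linkQ_vbackA`, `linkQ_vbackB`
(`d² = ‖bᵢ‖² + ‖bⱼ‖² - 2 (ρᵢ ρⱼ cos + αᵢ αⱼ)`) finish; the certified constants are in fact
`19.8 η` and `35.6 η`.  The square hypothesis on `n₄n₁` is not needed.

Mathlib + the landed link-lemma files + part 1; no named fact is used.
-/

noncomputable section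

namespace Summit.AtomisticToContinuum.Crystallization.Theorems.ZeroDefectDensityBirth

open scoped InnerProductSpace

/-! ## Points and pairs in the frame, first order in `η` -/

/-- **A common soft contact in the frame, quantitatively.**  On top of `link_vpoint`:
`|α - 1/2| ≤ 2.51 η`, `|ρ² - 3/4| ≤ 4.53 η`, `|‖b‖² - 1| ≤ 2.001 η`. [folklore] -/
theorem linkQ_vpoint {η : ℝ} {p c n : EuclideanSpace ℝ (Fin 3)}
    {ρ α : EuclideanSpace ℝ (Fin 3) → ℝ} (hα : ∀ q, α q * ‖p - c‖ = ⟪q, p - c⟫_ℝ)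
    (hρ0 : ∀ q, 0 ≤ ρ q) (hρ : ∀ q, ρ q ^ 2 = ‖q‖ ^ 2 - α q ^ 2) (hη0 : 0 ≤ η)
    (hη : η ≤ 1 / 1000) (hcp : 1 - η ≤ ‖c - p‖) (hcp' : ‖c - p‖ ≤ 1 + η)
    (hpn : 1 - η ≤ ‖p - n‖) (hpn' : ‖p - n‖ ≤ 1 + η) (hcn : 1 - η ≤ ‖c - n‖)
    (hcn' : ‖c - n‖ ≤ 1 + η) :
    ((0.497 ≤ α (n - c) ∧ α (n - c) ≤ 0.503 ∧ 0.7449 ≤ ρ (n - c) ^ 2 ∧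
      ρ (n - c) ^ 2 ≤ 0.755 ∧ 0 < ρ (n - c) ∧ 0.998001 ≤ ‖n - c‖ ^ 2 ∧ ‖n - c‖ ^ 2 ≤ 1.002001) ∧
      |α (n - c) - 1 / 2| ≤ 2.51 * η ∧ |ρ (n - c) ^ 2 - 3 / 4| ≤ 4.53 * η ∧
      |‖n - c‖ ^ 2 - 1| ≤ 2.001 * η) := by
  have old := link_vpoint hα hρ0 hρ hη0 hη hcp hcp' hpn hpn' hcn hcn'
  rw [norm_sub_rev] at hcp hcp' hcn hcn'
  have hin : α (n - c) * ‖p - c‖ = (‖n - c‖ ^ 2 + ‖p - c‖ ^ 2 - ‖p - n‖ ^ 2) / 2 := by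
    rw [hα, ← sub_sub_sub_cancel_right p n c, norm_sub_rev (p - c),
      norm_sub_sq_real (n - c) (p - c)]
    ring
  have hA := linkQ_alpha hη0 hη hcp hcp' hcn hcn' hpn hpn' hin
  have hB := linkQ_sq hη0 hη hcn hcn'
  exact ⟨old, hA, linkQ_rhoSq (hρ (n - c)) hB (linkQ_alphaMul hη0 hη hA hA), hB⟩

/-- **A soft contact pair, quantitatively**: planar cosine `1/3 ± 9.5 η`. [folklore] -/
theorem linkQ_vcontact {η : ℝ} {c n m : EuclideanSpace ℝ (Fin 3)}
    {x y ρ α : EuclideanSpace ℝ (Fin 3) → ℝ}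
    (hid : ∀ q q', 0 < ρ q → 0 < ρ q' →
      ⟪q, q'⟫_ℝ = ρ q * ρ q' * (x q * x q' + y q * y q') + α q * α q')
    (hn : ((0.497 ≤ α (n - c) ∧ α (n - c) ≤ 0.503 ∧ 0.7449 ≤ ρ (n - c) ^ 2 ∧
      ρ (n - c) ^ 2 ≤ 0.755 ∧ 0 < ρ (n - c) ∧ 0.998001 ≤ ‖n - c‖ ^ 2 ∧ ‖n - c‖ ^ 2 ≤ 1.002001) ∧
      |α (n - c) - 1 / 2| ≤ 2.51 * η ∧ |ρ (n - c) ^ 2 - 3 / 4| ≤ 4.53 * η ∧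
      |‖n - c‖ ^ 2 - 1| ≤ 2.001 * η))
    (hm : ((0.497 ≤ α (m - c) ∧ α (m - c) ≤ 0.503 ∧ 0.7449 ≤ ρ (m - c) ^ 2 ∧
      ρ (m - c) ^ 2 ≤ 0.755 ∧ 0 < ρ (m - c) ∧ 0.998001 ≤ ‖m - c‖ ^ 2 ∧ ‖m - c‖ ^ 2 ≤ 1.002001) ∧
      |α (m - c) - 1 / 2| ≤ 2.51 * η ∧ |ρ (m - c) ^ 2 - 3 / 4| ≤ 4.53 * η ∧
      |‖m - c‖ ^ 2 - 1| ≤ 2.001 * η))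
    (hη0 : 0 ≤ η) (hη : η ≤ 1 / 1000) (h1 : 1 - η ≤ ‖n - m‖) (h2 : ‖n - m‖ ≤ 1 + η) :
    |x (n - c) * x (m - c) + y (n - c) * y (m - c) - 1 / 3| ≤ 9.5 * η := by
  obtain ⟨⟨-, -, hρ1, hρ1', hρ1p, -, -⟩, hα1, hR1, hB1⟩ := hn
  obtain ⟨⟨-, -, hρ2, hρ2', hρ2p, -, -⟩, hα2, hR2, hB2⟩ := hm
  rw [← sub_sub_sub_cancel_right n m c] at h1 h2
  obtain ⟨hP, -⟩ := link_prod hρ1p hρ2p hρ1 hρ1' hρ2 hρ2'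
  exact linkQ_cosContact (hid _ _ hρ1p hρ2p) hP (linkQ_prod hρ1p hρ2p hR1 hR2)
    (linkQ_alphaMul hη0 hη hα1 hα2)
    (linkQ_gContact (norm_sub_sq_real (n - c) (m - c)) hB1 hB2 (linkQ_sq hη0 hη h1 h2))

/-- **A pinned square pair**: planar cosine `-1/3 ± 33.7 η`. [folklore] -/
theorem linkQ_vsquare {η : ℝ} {c n m : EuclideanSpace ℝ (Fin 3)}
    {x y ρ α : EuclideanSpace ℝ (Fin 3) → ℝ}
    (hid : ∀ q q', 0 < ρ q → 0 < ρ q' →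
      ⟪q, q'⟫_ℝ = ρ q * ρ q' * (x q * x q' + y q * y q') + α q * α q')
    (hn : ((0.497 ≤ α (n - c) ∧ α (n - c) ≤ 0.503 ∧ 0.7449 ≤ ρ (n - c) ^ 2 ∧
      ρ (n - c) ^ 2 ≤ 0.755 ∧ 0 < ρ (n - c) ∧ 0.998001 ≤ ‖n - c‖ ^ 2 ∧ ‖n - c‖ ^ 2 ≤ 1.002001) ∧
      |α (n - c) - 1 / 2| ≤ 2.51 * η ∧ |ρ (n - c) ^ 2 - 3 / 4| ≤ 4.53 * η ∧
      |‖n - c‖ ^ 2 - 1| ≤ 2.001 * η))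
    (hm : ((0.497 ≤ α (m - c) ∧ α (m - c) ≤ 0.503 ∧ 0.7449 ≤ ρ (m - c) ^ 2 ∧
      ρ (m - c) ^ 2 ≤ 0.755 ∧ 0 < ρ (m - c) ∧ 0.998001 ≤ ‖m - c‖ ^ 2 ∧ ‖m - c‖ ^ 2 ≤ 1.002001) ∧
      |α (m - c) - 1 / 2| ≤ 2.51 * η ∧ |ρ (m - c) ^ 2 - 3 / 4| ≤ 4.53 * η ∧
      |‖m - c‖ ^ 2 - 1| ≤ 2.001 * η))
    (hη0 : 0 ≤ η) (hη : η ≤ 1 / 1000) (h : |‖n - m‖ ^ 2 - 2| ≤ 38 * η) :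
    |x (n - c) * x (m - c) + y (n - c) * y (m - c) + 1 / 3| ≤ 33.7 * η := by
  obtain ⟨⟨-, -, hρ1, hρ1', hρ1p, -, -⟩, hα1, hR1, hB1⟩ := hn
  obtain ⟨⟨-, -, hρ2, hρ2', hρ2p, -, -⟩, hα2, hR2, hB2⟩ := hm
  rw [← sub_sub_sub_cancel_right n m c] at h
  obtain ⟨hP, -⟩ := link_prod hρ1p hρ2p hρ1 hρ1' hρ2 hρ2'
  exact linkQ_cosSquare (hid _ _ hρ1p hρ2p) hP (linkQ_prod hρ1p hρ2p hR1 hR2)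
    (linkQ_alphaMul hη0 hη hα1 hα2) (linkQ_gSquare (norm_sub_sq_real (n - c) (m - c)) hB1 hB2 h)

/-- **Back to space, near-antipodal pair**: planar cosine in `[-1, -1 + 1.09 η]` gives
`|d² - 3| ≤ 40 η`. [folklore] -/
theorem linkQ_vbackA {η : ℝ} {c n m : EuclideanSpace ℝ (Fin 3)}
    {x y ρ α : EuclideanSpace ℝ (Fin 3) → ℝ}
    (hid : ∀ q q', 0 < ρ q → 0 < ρ q' →
      ⟪q, q'⟫_ℝ = ρ q * ρ q' * (x q * x q' + y q * y q') + α q * α q')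
    (hn : ((0.497 ≤ α (n - c) ∧ α (n - c) ≤ 0.503 ∧ 0.7449 ≤ ρ (n - c) ^ 2 ∧
      ρ (n - c) ^ 2 ≤ 0.755 ∧ 0 < ρ (n - c) ∧ 0.998001 ≤ ‖n - c‖ ^ 2 ∧ ‖n - c‖ ^ 2 ≤ 1.002001) ∧
      |α (n - c) - 1 / 2| ≤ 2.51 * η ∧ |ρ (n - c) ^ 2 - 3 / 4| ≤ 4.53 * η ∧
      |‖n - c‖ ^ 2 - 1| ≤ 2.001 * η))
    (hm : ((0.497 ≤ α (m - c) ∧ α (m - c) ≤ 0.503 ∧ 0.7449 ≤ ρ (m - c) ^ 2 ∧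
      ρ (m - c) ^ 2 ≤ 0.755 ∧ 0 < ρ (m - c) ∧ 0.998001 ≤ ‖m - c‖ ^ 2 ∧ ‖m - c‖ ^ 2 ≤ 1.002001) ∧
      |α (m - c) - 1 / 2| ≤ 2.51 * η ∧ |ρ (m - c) ^ 2 - 3 / 4| ≤ 4.53 * η ∧
      |‖m - c‖ ^ 2 - 1| ≤ 2.001 * η))
    (hη0 : 0 ≤ η) (hη : η ≤ 1 / 1000) (h1 : -1 ≤ x (n - c) * x (m - c) + y (n - c) * y (m - c))
    (h2 : x (n - c) * x (m - c) + y (n - c) * y (m - c) ≤ -1 + 1.09 * η) :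
    |‖n - m‖ ^ 2 - 3| ≤ 40 * η := by
  obtain ⟨⟨-, -, hρ1, hρ1', hρ1p, -, -⟩, hα1, hR1, hB1⟩ := hn
  obtain ⟨⟨-, -, hρ2, hρ2', hρ2p, -, -⟩, hα2, hR2, hB2⟩ := hm
  rw [← sub_sub_sub_cancel_right n m c]
  obtain ⟨hP, hP'⟩ := link_prod hρ1p hρ2p hρ1 hρ1' hρ2 hρ2'
  exact linkQ_backA hη0 (norm_sub_sq_real (n - c) (m - c)) (hid _ _ hρ1p hρ2p) hB1 hB2
    (linkQ_prod hρ1p hρ2p hR1 hR2) (by linarith) hP' (linkQ_alphaMul hη0 hη hα1 hα2) h1 h2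

/-- **Back to space, two-contact pair**: planar cosine `-7/9 ± 12.9 η` gives
`|d² - 8/3| ≤ 60 η`. [folklore] -/
theorem linkQ_vbackB {η : ℝ} {c n m : EuclideanSpace ℝ (Fin 3)}
    {x y ρ α : EuclideanSpace ℝ (Fin 3) → ℝ}
    (hid : ∀ q q', 0 < ρ q → 0 < ρ q' →
      ⟪q, q'⟫_ℝ = ρ q * ρ q' * (x q * x q' + y q * y q') + α q * α q')
    (hn : ((0.497 ≤ α (n - c) ∧ α (n - c) ≤ 0.503 ∧ 0.7449 ≤ ρ (n - c) ^ 2 ∧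
      ρ (n - c) ^ 2 ≤ 0.755 ∧ 0 < ρ (n - c) ∧ 0.998001 ≤ ‖n - c‖ ^ 2 ∧ ‖n - c‖ ^ 2 ≤ 1.002001) ∧
      |α (n - c) - 1 / 2| ≤ 2.51 * η ∧ |ρ (n - c) ^ 2 - 3 / 4| ≤ 4.53 * η ∧
      |‖n - c‖ ^ 2 - 1| ≤ 2.001 * η))
    (hm : ((0.497 ≤ α (m - c) ∧ α (m - c) ≤ 0.503 ∧ 0.7449 ≤ ρ (m - c) ^ 2 ∧
      ρ (m - c) ^ 2 ≤ 0.755 ∧ 0 < ρ (m - c) ∧ 0.998001 ≤ ‖m - c‖ ^ 2 ∧ ‖m - c‖ ^ 2 ≤ 1.002001) ∧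
      |α (m - c) - 1 / 2| ≤ 2.51 * η ∧ |ρ (m - c) ^ 2 - 3 / 4| ≤ 4.53 * η ∧
      |‖m - c‖ ^ 2 - 1| ≤ 2.001 * η))
    (hη0 : 0 ≤ η) (hη : η ≤ 1 / 1000)
    (h : |x (n - c) * x (m - c) + y (n - c) * y (m - c) + 7 / 9| ≤ 12.9 * η) :
    |‖n - m‖ ^ 2 - 8 / 3| ≤ 60 * η := by
  obtain ⟨⟨-, -, hρ1, hρ1', hρ1p, -, -⟩, hα1, hR1, hB1⟩ := hn
  obtain ⟨⟨-, -, hρ2, hρ2', hρ2p, -, -⟩, hα2, hR2, hB2⟩ := hm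
  rw [← sub_sub_sub_cancel_right n m c]
  obtain ⟨hP, hP'⟩ := link_prod hρ1p hρ2p hρ1 hρ1' hρ2 hρ2'
  exact linkQ_backB hη0 (norm_sub_sq_real (n - c) (m - c)) (hid _ _ hρ1p hρ2p) hB1 hB2
    (linkQ_prod hρ1p hρ2p hR1 hR2) (by linarith) hP' (linkQ_alphaMul hη0 hη hα1 hα2) h

/-! ## The quantitative link lemma -/

/-- **Quantitative link lemma, type A** (contacts `n₁n₂`, `n₃n₄`; squares `n₂n₃`, `n₄n₁`
pinned; diagonals far): `|d₁₃² - 3|, |d₂₄² - 3| ≤ 40 η`. [folklore] -/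
theorem linkQ_typeA : ∀ (η : ℝ) (p c n₁ n₂ n₃ n₄ : EuclideanSpace ℝ (Fin 3)), 0 ≤ η → η ≤ 1 / 1000 → 1 - η ≤ dist c p → dist c p ≤ 1 + η → 1 - η ≤ dist p n₁ → dist p n₁ ≤ 1 + η → 1 - η ≤ dist p n₂ → dist p n₂ ≤ 1 + η → 1 - η ≤ dist p n₃ → dist p n₃ ≤ 1 + η → 1 - η ≤ dist p n₄ → dist p n₄ ≤ 1 + η → 1 - η ≤ dist c n₁ → dist c n₁ ≤ 1 + η → 1 - η ≤ dist c n₂ → dist c n₂ ≤ 1 + η → 1 - η ≤ dist c n₃ → dist c n₃ ≤ 1 + η → 1 - η ≤ dist c n₄ → dist c n₄ ≤ 1 + η → 1 - η ≤ dist n₁ n₂ → dist n₁ n₂ ≤ 1 + η → 1 - η ≤ dist n₃ n₄ → dist n₃ n₄ ≤ 1 + η → |dist n₂ n₃ ^ 2 - 2| ≤ 38 * η → |dist n₄ n₁ ^ 2 - 2| ≤ 38 * η → 131 / 100 ≤ dist n₁ n₃ → 131 / 100 ≤ dist n₂ n₄ → |dist n₁ n₃ ^ 2 - 3| ≤ 40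 * η ∧ |dist n₂ n₄ ^ 2 - 3| ≤ 40 * η := by
  intro η p c n₁ n₂ n₃ n₄ hη0 hη hcp hcp' hp₁ hp₁' hp₂ hp₂' hp₃ hp₃' hp₄ hp₄' hc₁ hc₁' hc₂ hc₂'
    hc₃ hc₃' hc₄ hc₄' h₁₂ h₁₂' h₃₄ h₃₄' s₂₃ _s₄₁ f₁₃ f₂₄
  simp only [dist_eq_norm] at *
  have ha : p - c ≠ 0 := by
    intro h
    rw [norm_sub_rev, h, norm_zero] at hcp
    linarith
  obtain ⟨x, y, ρ, α, hα, hρ0, hρ, hxy, hid⟩ := link_frame (p - c) ha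
  have P₁ := linkQ_vpoint hα hρ0 hρ hη0 hη hcp hcp' hp₁ hp₁' hc₁ hc₁'
  have P₂ := linkQ_vpoint hα hρ0 hρ hη0 hη hcp hcp' hp₂ hp₂' hc₂ hc₂'
  have P₃ := linkQ_vpoint hα hρ0 hρ hη0 hη hcp hcp' hp₃ hp₃' hc₃ hc₃'
  have P₄ := linkQ_vpoint hα hρ0 hρ hη0 hη hcp hcp' hp₄ hp₄' hc₄ hc₄'
  have u₁ := hxy _ P₁.1.2.2.2.2.1
  have u₂ := hxy _ P₂.1.2.2.2.2.1
  have u₃ := hxy _ P₃.1.2.2.2.2.1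
  have u₄ := hxy _ P₄.1.2.2.2.2.1
  rw [norm_sub_rev] at h₃₄ h₃₄' f₂₄
  constructor
  · obtain ⟨e₁, e₂⟩ := linkQ_antipodal hη0 hη u₁ u₂ u₃ (linkQ_vcontact hid P₁ P₂ hη0 hη h₁₂ h₁₂')
      (linkQ_vsquare hid P₂ P₃ hη0 hη s₂₃) (link_vfar hid P₁.1 P₃.1 f₁₃)
    exact linkQ_vbackA hid P₁ P₃ hη0 hη e₁ e₂
  · rw [norm_sub_rev] at s₂₃ ⊢
    obtain ⟨e₁, e₂⟩ := linkQ_antipodal hη0 hη u₄ u₃ u₂ (linkQ_vcontact hid P₄ P₃ hη0 hη h₃₄ h₃₄')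
      (linkQ_vsquare hid P₃ P₂ hη0 hη s₂₃) (link_vfar hid P₄.1 P₂.1 f₂₄)
    exact linkQ_vbackA hid P₄ P₂ hη0 hη e₁ e₂

/-- **Quantitative link lemma, type B** (contacts `n₁n₂`, `n₂n₃`; squares `n₃n₄`, `n₄n₁`
pinned; diagonals far): `|d₁₃² - 8/3| ≤ 60 η` and `|d₂₄² - 3| ≤ 40 η`. [folklore] -/
theorem linkQ_typeB : ∀ (η : ℝ) (p c n₁ n₂ n₃ n₄ : EuclideanSpace ℝ (Fin 3)), 0 ≤ η → η ≤ 1 / 1000 → 1 - η ≤ dist c p → dist c p ≤ 1 + η → 1 - η ≤ dist p n₁ → dist p n₁ ≤ 1 + η → 1 - η ≤ dist p n₂ → dist p n₂ ≤ 1 + η → 1 - η ≤ dist p n₃ → dist p n₃ ≤ 1 + η → 1 - η ≤ dist p n₄ → dist p n₄ ≤ 1 + η → 1 - η ≤ dist c n₁ → dist c n₁ ≤ 1 + η → 1 - η ≤ dist c n₂ → dist c n₂ ≤ 1 + η → 1 - η ≤ dist c n₃ → dist c n₃ ≤ 1 + η → 1 - η ≤ dist c n₄ → dist c n₄ ≤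 1 + η → 1 - η ≤ dist n₁ n₂ → dist n₁ n₂ ≤ 1 + η → 1 - η ≤ dist n₂ n₃ → dist n₂ n₃ ≤ 1 + η → |dist n₃ n₄ ^ 2 - 2| ≤ 38 * η → |dist n₄ n₁ ^ 2 - 2| ≤ 38 * η → 131 / 100 ≤ dist n₁ n₃ → 131 / 100 ≤ dist n₂ n₄ → |dist n₁ n₃ ^ 2 - 8 / 3| ≤ 60 * η ∧ |dist n₂ n₄ ^ 2 - 3| ≤ 40 * η := by
  intro η p c n₁ n₂ n₃ n₄ hη0 hη hcp hcp' hp₁ hp₁' hp₂ hp₂' hp₃ hp₃' hp₄ hp₄' hc₁ hc₁' hc₂ hc₂'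
    hc₃ hc₃' hc₄ hc₄' h₁₂ h₁₂' h₂₃ h₂₃' s₃₄ _s₄₁ f₁₃ f₂₄
  simp only [dist_eq_norm] at *
  have ha : p - c ≠ 0 := by
    intro h
    rw [norm_sub_rev, h, norm_zero] at hcp
    linarith
  obtain ⟨x, y, ρ, α, hα, hρ0, hρ, hxy, hid⟩ := link_frame (p - c) ha
  have P₁ := linkQ_vpoint hα hρ0 hρ hη0 hη hcp hcp' hp₁ hp₁' hc₁ hc₁'
  have P₂ := linkQ_vpoint hα hρ0 hρ hη0 hη hcp hcp' hp₂ hp₂' hc₂ hc₂'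
  have P₃ := linkQ_vpoint hα hρ0 hρ hη0 hη hcp hcp' hp₃ hp₃' hc₃ hc₃'
  have P₄ := linkQ_vpoint hα hρ0 hρ hη0 hη hcp hcp' hp₄ hp₄' hc₄ hc₄'
  have u₁ := hxy _ P₁.1.2.2.2.2.1
  have u₂ := hxy _ P₂.1.2.2.2.2.1
  have u₃ := hxy _ P₃.1.2.2.2.2.1
  have u₄ := hxy _ P₄.1.2.2.2.2.1
  have c₂₃ := linkQ_vcontact hid P₂ P₃ hη0 hη h₂₃ h₂₃'
  constructor
  · exact linkQ_vbackB hid P₁ P₃ hη0 hη (linkQ_twoContacts hη0 hη u₁ u₂ u₃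
      (linkQ_vcontact hid P₁ P₂ hη0 hη h₁₂ h₁₂') c₂₃ (link_vfar hid P₁.1 P₃.1 f₁₃))
  · obtain ⟨e₁, e₂⟩ := linkQ_antipodal hη0 hη u₂ u₃ u₄ c₂₃ (linkQ_vsquare hid P₃ P₄ hη0 hη s₃₄)
      (link_vfar hid P₂.1 P₄.1 f₂₄)
    exact linkQ_vbackA hid P₂ P₄ hη0 hη e₁ e₂

/-- **The quantitative link lemma** (registered stub `stub_linkQ` of the birth line, verbatim):
the conjunction of `linkQ_typeA` and `linkQ_typeB`. [folklore] -/
theorem stub_linkQ : (∀ (η : ℝ) (p c n₁ n₂ n₃ n₄ : EuclideanSpace ℝ (Fin 3)), 0 ≤ η → η ≤ 1 / 1000 → 1 - η ≤ dist c p → dist c p ≤ 1 + η → 1 - η ≤ dist p n₁ → dist p n₁ ≤ 1 + η → 1 - η ≤ dist p n₂ → dist p n₂ ≤ 1 + η → 1 - η ≤ dist p n₃ → dist p n₃ ≤ 1 + η → 1 - η ≤ dist p n₄ → dist p n₄ ≤ 1 + η → 1 - η ≤ dist c n₁ → dist c n₁ ≤ 1 + η → 1 - η ≤ dist c n₂ →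 dist c n₂ ≤ 1 + η → 1 - η ≤ dist c n₃ → dist c n₃ ≤ 1 + η → 1 - η ≤ dist c n₄ → dist c n₄ ≤ 1 + η → 1 - η ≤ dist n₁ n₂ → dist n₁ n₂ ≤ 1 + η → 1 - η ≤ dist n₃ n₄ → dist n₃ n₄ ≤ 1 + η → |dist n₂ n₃ ^ 2 - 2| ≤ 38 * η → |dist n₄ n₁ ^ 2 - 2| ≤ 38 * η → 131 / 100 ≤ dist n₁ n₃ → 131 / 100 ≤ dist n₂ n₄ → |dist n₁ n₃ ^ 2 - 3| ≤ 40 * η ∧ |dist n₂ n₄ ^ 2 - 3| ≤ 40 * η) ∧ (∀ (η : ℝ) (p c n₁ n₂ n₃ n₄ : EuclideanSpace ℝ (Fin 3)), 0 ≤ η → η ≤ 1 / 1000 → 1 - η ≤ dist c p → dist c p ≤ 1 + η → 1 - η ≤ dist p n₁ → dist p n₁ ≤ 1 + η → 1 - η ≤ dist p n₂ → dist p n₂ ≤ 1 + η → 1 - η ≤ dist p n₃ → dist p n₃ ≤ 1 + η → 1 - η ≤ dist p n₄ → dist p n₄ ≤ 1 + η → 1 - η ≤ dist c n₁ → dist c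 n₁ ≤ 1 + η → 1 - η ≤ dist c n₂ → dist c n₂ ≤ 1 + η → 1 - η ≤ dist c n₃ → dist c n₃ ≤ 1 + η → 1 - η ≤ dist c n₄ → dist c n₄ ≤ 1 + η → 1 - η ≤ dist n₁ n₂ → dist n₁ n₂ ≤ 1 + η → 1 - η ≤ dist n₂ n₃ → dist n₂ n₃ ≤ 1 + η → |dist n₃ n₄ ^ 2 - 2| ≤ 38 * η → |dist n₄ n₁ ^ 2 - 2| ≤ 38 * η → 131 / 100 ≤ dist n₁ n₃ → 131 / 100 ≤ dist n₂ n₄ → |dist n₁ n₃ ^ 2 - 8 / 3| ≤ 60 * η ∧ |dist n₂ n₄ ^ 2 - 3| ≤ 40 * η) :=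
  ⟨linkQ_typeA, linkQ_typeB⟩

end Summit.AtomisticToContinuum.Crystallization.Theorems.ZeroDefectDensityBirth
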